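import Summits.KontsevichZagierPeriods.KontsevichZagierPeriods.Theses.SymplecticScissors
import Summits.KontsevichZagierPeriods.KontsevichZagierPeriods.Theorems.RealOnePeriodRelations.Negative.Kit
import Summits.KontsevichZagierPeriods.KontsevichZagierPeriods.Theorems.SymplecticScissorsRealOnePeriodRelationsStubSaChart
import Summits.KontsevichZagierPeriods.KontsevichZagierPeriods.Theorems.SymplecticScissorsRealOnePeriodRelationsStubSaPathSubset
import Summits.KontsevichZagierPeriods.KontsevichZagierPeriods.Theorems.SymplecticScissorsRealOnePeriodRelationsStubGreenOnSquare
import Summits.KontsevichZagierPeriods.KontsevichZagierPeriods.Theorems.SymplecticScissorsRealOnePeriodRelationsStubCellGreen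
import Summits.KontsevichZagierPeriods.KontsevichZagierPeriods.Theorems.SymplecticScissorsRealOnePeriodRelationsStubHomotopyInvariance
import Summits.KontsevichZagierPeriods.KontsevichZagierPeriods.Theorems.SymplecticScissorsRealOnePeriodRelationsStubSaHomotopic
import Summits.KontsevichZagierPeriods.KontsevichZagierPeriods.Theorems.SymplecticScissorsRealOnePeriodRelationsStubExactDimOne
import Summits.KontsevichZagierPeriods.KontsevichZagierPeriods.Theorems.SymplecticScissorsRealOnePeriodRelationsStubRealises
import Summits.KontsevichZagierPeriods.KontsevichZagierPeriods.Theorems.SymplecticScissorsRealOnePeriodRelationsStubRetraction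
import Literature.NumberTheory.Transcendental.KZCalculus
import Literature.NumberTheory.Transcendental.CurvePeriods
import Literature.NumberTheory.Transcendental.SemialgebraicMaps

/-!
# `CurvePeriodsTransfer` — stub `stub_realisation` of line `standard-etale-models`, discharged by the
Θ-chain of the sibling crux `RealOnePeriodRelations` (line `nash-retraction-thin-strip`)

The registered stub `stub_realisation` of crux `stmt-KontsevichZagierPeriods-11129` asks for a realisation map
`Θ : ℂ → PeriodSymbol → KZ.FormalRep` which (i) kills every `ℚ̄`-combination of elementary relations modulo `M₁` and
(ii) agrees modulo `M₁` with any realisation of `a • s` along a `ℚ`-semialgebraic symbol path.  This is VERBATIM the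
conclusion of `RealOnePeriodRelations.stub_retraction`, whose four hypotheses are the landed stubs of the sibling line:
semialgebraic homotopic replacement of paths (`stub_saHomotopic` from `stub_saChart`, `stub_saPathSubset`), homotopy
invariance of realisations modulo `M₁` (`stub_homotopyInvariance` from `stub_saChart`, `stub_saPathSubset`,
`stub_cellGreen`, `stub_greenOnSquare`), exactness in dimension one (`stub_exactDimOne`) and existence of realisations
(`stub_realises`).  [cite: HuberWustholz2022, Thm 13.3 (2)] [cite: KontsevichZagier2001, §1.2]
-/

noncomputable section

open scoped BigOperators Topology unitInterval
open Set MeasureTheory Filter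
open Literature.NumberTheory.Transcendental Literature.NumberTheory.Transcendental.CurvePeriods
open Literature.ModelTheory.ExponentialFields (IsSemialgebraic)
open Summit.KontsevichZagierPeriods.SymplecticScissors.RealOnePeriodRelationsNegative (greenSet M₁ H₁)

namespace Summit.KontsevichZagierPeriods.SymplecticScissors.CurvePeriodsTransfer

open Summit.KontsevichZagierPeriods.SymplecticScissors.RealOnePeriodRelations in
/-- **Stub `stub_realisation` (crux `CurvePeriodsTransfer`, line `standard-etale-models`).** The realisation map `Θ`
of period symbols into formal one-dimensional KZ-representatives: it kills `ℚ̄`-combinations of elementary relations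
modulo `M₁` and agrees with every realisation along a `ℚ`-semialgebraic path modulo `M₁`.  Discharged by the sibling
line's retraction theorem applied to its landed coherence stubs. [cite: HuberWustholz2022, Thm 13.3 (2)] -/
theorem stub_realisation : ∃ Θ : ℂ → PeriodSymbol → KZ.FormalRep,
    (∀ (k : ℕ) (ρ : Fin k → (PeriodSymbol →₀ ℂ)) (a : Fin k → ℂ), (∀ l, IsElementaryRelation (ρ l)) →
      (∀ l, IsAlgebraic ℚ (a l)) → ((∑ l, a l • ρ l).sum fun s b => Θ b s) ∈ M₁) ∧
    (∀ (s : PeriodSymbol) (a : ℂ), IsAlgebraic ℚ a →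
      IsSemialgebraicMapOn ℚ {z : Fin 1 → ℝ | z 0 ∈ Set.Icc (0 : ℝ) 1}
        (fun z => Fin.append (fun i => (s.γ.toFun (z 0) i).re) (fun i => (s.γ.toFun (z 0) i).im)) →
      ∀ (r : KZ.IntegralRep 1),
        (r.domain = {z | z 0 ∈ Set.Ioo (0 : ℝ) 1} ∧ ∀ z ∈ r.domain, r.integrand z =
          (a * ∑ i, MvPolynomial.eval (s.γ.toFun (z 0)) (s.ω i) * deriv (fun u => s.γ.toFun u i) (z 0)).re) →
        Θ a s - KZ.of r ∈ M₁) :=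
  stub_retraction (stub_saHomotopic stub_saChart (stub_saPathSubset stub_saChart))
    (stub_homotopyInvariance stub_saChart (stub_saPathSubset stub_saChart) (stub_cellGreen stub_greenOnSquare))
    stub_exactDimOne stub_realises

end Summit.KontsevichZagierPeriods.SymplecticScissors.CurvePeriodsTransfer

end
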